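import Mathlib
import HarnessLib
import HarnessLib.Audit
import Summits.QuantumFields.Statement
import Literature.Barriers.QuantumFields.WilsonDeterminantSign
import Summits.QuantumFields.QCD.Theorems.NestedDissectionSeaThresholdShift
import HarnessLib.Audit.Status.Attr

/-!
Route: IntegerCriticalLine

# Route IntegerCriticalLine — the Wilson critical line as an index jump — mobility-gap plateaux of
the gauge-disordered Wilson–Dirac kernel, forced delocalisation, and QCD on the trivial plateau

It suffices to show X = P ∧ B ∧ E (card QuantumFields/QCD/integer-critical-line-chern-index: its K3
→ P, its assembly
consumer → B, the shared UV existence → E), carried by the card's own theorem Y = L ∧ C (its K1 → L,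
its Move 2 / K2 → C).
The object throughout is ONE random operator: the Hermitian Wilson–Dirac kernel H(m₀)[U] = Γ₅ D_W(U,
m₀, r = 1) (tree
`hermitianWilsonDirac`) over SU(3) link fields drawn from the Wilson measure — literally the
periodic unitary-class model of
Prodan–Schulz-Baldes §2.2.4 (free second Chern numbers 0 | 1 | −3 | 3 | −1 | 0 across m₀ = 0, −2,
−4, −6, −8,
Golterman–Jansen–Kaplan 1993) with Gibbs-distributed unitary hopping disorder. P
(PhysicalPlateauMobilityGap): along every
admissible, chiral-at-zero mass-independent regularisation, above a SHARP threshold M₀ (the lattice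
gap closes as m ↓ M₀;
M₀ = 0 for an honest regularisation — statement re-type 2026-08-16), the kernel at the trajectory's
bare mass has 0 in an
Aizenman–Molchanov MOBILITY GAP (PSB's hypothesis MBGH (2.51), verbatim, under the phase-quenched
lattice-QCD measure) of
half-width ∝ a_k(m_f − M₀)/Z_m(k) with fractional-moment decay at the RENORMALISED rate ∝ a_k(m_f −
M₀) per lattice step — the
trajectory sits on the trivial (Chern number 0) plateau, quantitatively. B (PlateauBridge): that
mobility gap ⇒ the full
lattice and continuum gap for every continuum limit along the scheme (γ₅-domination for quark lines,
quasi-local sea with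
localised sign defects, robust SU(3) Yang–Mills core — named, not evaded). E
(DynamicalQuarkContinuum): the gap-free UV
existence half shared by every QCD line, PINNED AT THE CHIRAL POINT (`reg.IsChiralAtZero`: the
lattice gap closes as
m → 0⁺). Y is what the card adds to the pool and what justifies DEFINING m_crit(β) as an index
jump: L (InteriorPlateauLocalisation) — at β ≥ β₁ the kernel at the interior mass m₀ = −1 (first
topological pocket) has 0 in
a mobility gap under the quenched Wilson measure, uniformly in the torus; C (CriticalLineExists) —
no Aizenman–Molchanov bound
holds uniformly across m₀ ∈ [−1, 1]: between the pocket (almost-sure second Chern number 1) and the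
trivial insulator m₀ > 0
(Chern number 0, pathwise gap) the spectrum at 0 must DELOCALISE, i.e. the Wilson chiral critical
line m_c(β) ∈ (−1, 0] exists
at every weak coupling as a sharp transition — the d = 4, mass-parameter twin of
Germinet–Klein–Schenker's delocalisation
between Hall plateaux, forced by PSB Cor. 6.5.2 (strong Chern numbers are constant while MBGH
holds).
P → B → E → ThresholdShift → QCD is pure logic (Sketch.lean, `closes`, axioms
propext/choice/Quot.sound).
Lean: `PhysicalPlateauMobilityGap ∧ PlateauBridge ∧ DynamicalQuarkContinuum`

## Assembly
Pure logic, term-checked sorry-free in the planner's Sketch.lean (`closes`, axioms propext /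
Classical.choice / Quot.sound):
fix N_f ∈ {2,3}; DynamicalQuarkContinuum gives reg with HasMassScaling, IsChiralAtZero and, for
every m > 0, (z, shift, T) with IsQCDAlong, the
glue clauses and non-decoupling — in particular the admissibility data; PhysicalPlateauMobilityGap
gives M₀ ≥ 0, s ∈ (0,1), the EDGE clause (for every ε > 0 a tuple m with all m_f > M₀
and ¬(reg.scheme m 0 0).HasLatticeMassGap ε) and the mobility-gap bounds above M₀; PlateauBridge
turns them into ∃ Δ > 0, T.HasMassGap Δ ∧ HasLatticeMassGap Δ for every m > M₀ and
every such T; ThresholdShift produces reg′ with reg′.scheme m = reg.scheme (m + M₀), which witnesses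
`QCDOf N_f` (for m > 0,
m + M₀ > M₀; reg′.IsChiralAtZero follows from the edge clause via m ↦ m − M₀, as reg′.scheme m 0 0 =
reg.scheme (m + M₀) 0 0); then `QCD = QCDOf 2 ∧ QCDOf 3`. InteriorPlateauLocalisation and
CriticalLineExists are the route's theorem about
the regularisation (existence and definition of the critical line) and stay outside the chain by
design.

Rationale: WHY THIS LINE. Transplant with an explicit dictionary (disordered topological insulators ↦ Wilson
lattice QCD): QWZ/QHZ lattice Chern insulator
↦ the free Wilson–Dirac kernel itself (same operator: GoltermanJansenKaplan1993; Kimura2016 eq.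
(2.10); ProdanSchulzbaldes2016
§2.2.4 (2.24)); on-site disorder ↦ Haar links under the Wilson measure at β; Fermi level in a
mobility gap ↦ 0 ∈ mobility gap of
Γ₅D_W (GoltermanShamir2003's mobility edge λ_c > 0, made the Aizenman–Molchanov bound of
AizenmanMolchanov1993 / AizenmanGraf1998
= PSB's MBGH (2.51)); disorder-renormalised topological mass of the topological Anderson insulator
(LiEtAl2009, GrothEtAl2009)
↦ the additive mass renormalisation m_c(β) < 0; almost-sure noncommutative second Chern number,
quantised and constant on
mobility gaps (ProdanLeungBellissard2013; ProdanSchulzbaldes2016 Thm 6.5.1 / Cor. 6.5.2) ↦ an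
INTEGER order parameter C(m₀; β)
whose jump locus DEFINES the critical line; "plateau change forces delocalisation"
(GerminetKleinSchenker2007, d = 2) ↦
EXISTENCE of κ_c(β) at all weak coupling (CriticalLineExists) — which Golterman–Shamir state only as
a conjecture ("we have no
proof that it is correct", GoltermanShamir2003 §4). Imported areas: C*-algebraic index theory of
covariant operator families and
fractional-moment localisation (random Schrödinger operators); constructive block RG only inside
P/B/E. What it does that the
pool does not (negatives index empty; the sister card wilson-dirac-mobility-gap shares the
localisation ENGINE but works at real
energy 0 only and has no index): it gives the witness datum `reg.mcrit` a tuning-free,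
gauge-invariant, non-perturbative
definition (LinearDivergenceRenormalon evaded by construction), turns "the chiral critical line
exists and is sharp" into a
forced-delocalisation theorem with a typed finite-volume form, states the physical-side input at
mobility-GAP strength (complex
energies in a window — what index theory and sea quasi-locality consume, PSB Prop. 2.4.4), and pins
its s = 2 endpoint to hadron
physics by an exact identity (PionContractionEqNormSq: the second moment of the E = 0 Green function
IS the flavoured
pseudoscalar correlator).

RANKED CRUXES. #2 InteriorPlateauLocalisation (crux) — (card K1, quenched form) there are β₁, s ∈
(0,1), E₀ > 0, C and c > 0 such that for every inverse coupling β ≥ β₁ (tree normalisation β =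
2/g₀², `wilsonMeasure` with the fundamental SU(3) representation), every torus of side 2S+1, every
energy |E| ≤ E₀, every η > 0, every displacement v ∈ ℤ⁴ with |v_i| ≤ S and all colour/spin indices,
the Wilson-measure expectation of the s-th power of the (0,a,α; v,b,γ) entry of the resolvent
(Γ₅D_W(U, m₀ = −1, r = 1) − E − iη)⁻¹ is at most C·exp(−c|v|₁): at weak coupling the kernel in the
first topological pocket has 0 in an Aizenman–Molchanov mobility gap (PSB's MBGH (2.51)), uniformly
in the volume — the first localisation theorem for non-abelian Haar-link (Gibbs) disorder, toy rung
of PhysicalPlateauMobilityGap and engine of CriticalLineExists. [difficulty: L] (why it might fail: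
Gibbs-correlated, unitary, only TYPICALLY weak disorder: the Wegner input must come from single-link
conditional Haar densities (constants ~ e^(cβ)) and be beaten by the e^(−c′β) dislocation/Lifshitz
exponent at the initial scale; if the exponents do not separate the induction never starts.)
[AizenmanMolchanov1993, AizenmanGraf1998, ProdanSchulzbaldes2016, GoltermanShamir2003,
GoltermanShamirSvetitsky2005, EdwardsHellerNarayanan1998]
#3 PhysicalPlateauMobilityGap (crux) — (card K3, statement-exact, re-typed 2026-08-16; in the
assembly) for N_f ∈ {2,3} and every `reg : QCDRegularisation N_f` with `HasMassScaling` and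
`IsChiralAtZero` carrying admissibility data (for every m > 0 some z, shift, T with `IsQCDAlong
(reg.scheme m z shift) T` and `T.IsNontrivial (pseudoRe f g)` for f ≠ g), there are a SHARP
threshold M₀ ≥ 0 — for every ε > 0 some tuple m with all m_f > M₀ has no uniform lattice gap ε, `¬
(reg.scheme m 0 0).HasLatticeMassGap ε`: the gap closes as m ↓ M₀ (M₀ = 0 for an honest
regularisation, where this IS the hypothesis; M₀ > 0 only absorbs a critical bare mass placed below
the chiral line) — and s ∈ (0,1) such that for every window bound M̄ there is c > 0 with: for every
tuple m ∈ (M₀, M̄]^N_f some C, eventually in k, on every torus 2S+1 ≥ 2L_k+1, for every flavour f,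
every |E| ≤ c·a_k(m_f − M₀)/Z_m(k), every η > 0, every v with |v_i| ≤ S and all indices, the
expectation under the PHASE-QUENCHED lattice-QCD probability measure Z⁻¹e^(−β_k S_W)∏_g|det D_W(U,
m_g(k), 1)| (tree `qcdLatticeMeasure`, bare masses m_g(k) = m_crit(k) + a_k m_g/Z_m(k)) of
‖(Γ₅D_W(U, m_f(k), 1) − E − iη)⁻¹(0,a,α; v,b,γ)‖^s is at most C·exp(−c·a_k(m_f − M₀)·|v|₁): on the
physical side the kernel has 0 in a mobility gap whose half-width is the bare subtracted mass and
whose fractional-moment decay rate is the RENORMALISED mass in lattice units — the trajectory lies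
on the trivial plateau, quantitatively, with the sign of ∏det left to the bridge. [deps:
InteriorPlateauLocalisation] [difficulty: open-problem] (why it might fail: at the cutoff
gap/disorder → 0 (a·m/Z_m against g₀²), so E ≈ 0 localisation needs block RG down to scale 1/m
before any Lifshitz argument, and the physical-unit rate must be the renormalised mass although U ≡
1 saturates every pathwise bound at the bare one; the edge clause dies if an admissible chiral
regularisation is gapless only at split tuples, not above one flavour-blind M₀.)
[GoltermanShamir2003, doi:10.1088/1126-6708/2006/02/011, AizenmanMolchanov1993,
BalabanOcarrollSchor1989, MontvayMunster1994, SharpeSingleton1998]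
#4 CriticalLineExists (crux) — (card Move 2 / K2 output, typed in PSB's finite-volume language)
there is β₁ such that for every β ≥ β₁ NO constants s ∈ (0,1), E₀ > 0, C, c > 0 make the
Aizenman–Molchanov bound of InteriorPlateauLocalisation hold simultaneously for all Wilson masses m₀
∈ [−1, 1] (all tori, |E| ≤ E₀, η > 0, all displacements): between the first topological pocket (m₀ =
−1, almost-sure second Chern number 1 by InteriorPlateauLocalisation + the contraction homotopy U ↦
U^t + the free value) and the trivial insulator (m₀ > 0: pathwise gap by TrivialPlateauGap, Chern
number 0) the spectrum of Γ₅D_W at 0 is DELOCALISED somewhere (PSB Def. 2.4.3) — the Wilson chiral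
critical line m_c(β) ∈ (−1, 0] exists at every weak coupling as a sharp localisation–delocalisation
transition, whatever the Aoki-phase scenario; intended proof: strong even Chern numbers are constant
while MBGH holds (PSB Thm 6.5.1 / Cor. 6.5.2) — the d = 4, mass-parameter twin of
Germinet–Klein–Schenker. [deps: InteriorPlateauLocalisation] [difficulty: L] (why it might fail: the
forcing argument must port the a.s. index to Gibbs (non-product, possibly non-ergodic) SU(3)-link
disorder, evaluate C(−1) = 1 via MBGH along U ↦ U^t, and get local uniformity of AM bounds in m₀;
compactness then converts pointwise MBGH on [−1,1] into the uniform bound negated here.)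
[GerminetKleinSchenker2007, ProdanSchulzbaldes2016, ProdanLeungBellissard2013,
GoltermanJansenKaplan1993, GoltermanShamir2003, Aoki1984WilsonPhase, EdwardsHellerNarayanan1998]
#5 PlateauBridge (crux) — (the card's consumer, statement-exact; in the assembly) for N_f ∈ {2,3},
every admissible `reg` with `HasMassScaling`, every M₀ ≥ 0 and s ∈ (0,1) for which the conclusion of
PhysicalPlateauMobilityGap holds: for all m with every m_f > M₀ and all z, shift, T with `IsQCDAlong
(reg.scheme m z shift) T` there is Δ > 0 with `T.HasMassGap Δ ∧ (reg.scheme m z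
shift).HasLatticeMassGap Δ`. Content: (i) flavoured channels — γ₅-domination (Weingarten) bounds
every quark-line-connected correlator of `QCDLatticeObservable`s by moments of the propagator, whose
s = 2 endpoint is the pseudoscalar correlator (PionContractionEqNormSq); (ii) sea — in the mobility
gap the Fermi projection and log|det D_W| are quasi-local in U (PSB Prop. 2.4.4) and sign det
D_W(m_f(k)) = (−1)^ν with ν a count of LOCALISED level crossings on the trivial plateau (tree
`fermionDet_wilsonDirac_eq_sign_mul`; card Move 3), so the signed N_f-flavour weight is a
quasi-local, dilute-defect perturbation of Wilson's action; (iii) volume-uniform clustering of such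
perturbed SU(3) measures at weak coupling — the Yang–Mills core, listed for honesty; (iv) Lüscher's
transfer matrix from lattice decay to `T.HasMassGap`. [deps: PhysicalPlateauMobilityGap]
[difficulty: open-problem] (why it might fail: Millennium-grade: (iii) is a robust SU(3) Yang–Mills
lattice gap under quasi-local SIGNED perturbations; (ii) needs the sign-defect activity to vanish
fast enough in k for odd exposure (N_f = 3, split doublets) on ALL tori S ≥ L_k, where naive
reweighting fails exponentially in the volume.) [JaffeWitten2000, Weingarten1983,
ProdanSchulzbaldes2016, Luscher1977, Balaban1989LargeFieldII, doi:10.1103/physrevd.102.074506]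
#6 DynamicalQuarkContinuum (crux) — (the UV existence half shared by every QCD line, stated gap-free
and pinned at the chiral point — statement re-type 2026-08-16; in the assembly) for N_f = 2 and N_f
= 3 there is `reg : QCDRegularisation N_f` with `HasMassScaling` and `IsChiralAtZero` (the lattice
gap closes as m → 0⁺) such that for every m > 0 some z, shift and `T : OSData (QCDField N_f) 4`
satisfy `IsQCDAlong (reg.scheme m z shift) T`, `T.IsNontrivial glue`, `T.IsNonGaussian glue` and
`T.IsNontrivial (pseudoRe f g)` for all f ≠ g. On this line the flavour-blind datum `reg.mcrit k` is
OFFERED a canonical value — the index-jump mass m_c(β_k) of CriticalLineExists (definition request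
topologicalCriticalMass) — so that no counterterm is tuned; the construction must show the flow
lands on it; `IsChiralAtZero` then says the index jump IS the chiral point: where Γ₅D_W delocalises
at 0, the second moment of the E = 0 Green function — the flavoured pseudoscalar correlator
(PionContractionEqNormSq) — loses uniform exponential decay. [difficulty: open-problem] (why it
might fail: no 4D construction with dynamical fermions exists (BOS is external-field, Dimock is
QED₃); even with m_crit defined by the index jump the block flow must be shown to realise it within
o(a_k/Z_m); IsNonGaussian glue needs observable-level control; IsChiralAtZero imports gaplessness of
N_f ≥ 2 lattice QCD at the critical line (light pions).) [Balaban1988Convergent,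
BalabanOcarrollSchor1989, Dimock2022QED3, JaffeWitten2000, ProdanSchulzbaldes2016]
#9 ThresholdShift (support) — (assembly glue, the statement's audit-g7 shift; provable now; shared
item) for every `reg` and M₀ there is `reg'` (same a, β, L, Z_m; m_crit'(k) = m_crit(k) + a_k
M₀/Z_m(k)) with `reg.HasMassScaling → reg'.HasMassScaling` and `reg'.scheme m z shift = reg.scheme
(m + M₀) z shift` for all m, z, shift. [difficulty: provable-now] [MontvayMunster1994,
tree:Literature.MathematicalPhysics.QuantumFieldTheory.QCDRegularisation.scheme_mq]
#9 TrivialPlateauGap (support) — (card P1(b); provable now) for a unitary colour representation ρ,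
any gauge field U on any four-torus, m ≥ 0 and r ≥ 0, the Hermitian Wilson–Dirac operator satisfies
‖Γ₅D_W(U,m,r)v‖² ≥ m²‖v‖² for every vector v: the Hermitian part of D_W is m + (Wilson term ≥ 0), so
Re⟨v, D_W v⟩ ≥ m‖v‖², Cauchy–Schwarz, and Γ₅ is unitary. Hence for m₀ > 0 the spectrum of H avoids
(−m₀, m₀) for EVERY configuration: the trivial insulator side (Chern number 0, Q = 0, det D_W > 0)
of the dictionary, where pathwise Combes–Thomas already gives MBGH. [difficulty: provable-now]
[MontvayMunster1994, VafaWitten1984NPB,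
tree:Literature.Barriers.QuantumFields.WilsonDeterminantSign_holds]
#9 PionContractionEqNormSq (support) — (dictionary entry "second moment of the E = 0 Green function
= flavoured pseudoscalar correlator"; provable now) for every SU(3) gauge field U on any four-torus,
every real m and sites x, y, the tree's equal-mass pion contraction tr[G(x,y) γ₅ G(y,x) γ₅] equals
Σ_(a,b,α,β) |G(x,a,α; y,b,β)|², G = `quarkPropagator U m` = D_W⁻¹: γ₅-hermiticity (tree
`wilsonDirac_gammaFive_hermitian_holds`) gives D_W⁻¹ = Γ₅(D_W⁻¹)†Γ₅ blockwise, Γ₅ = diag(1,1,−1,−1);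
both sides vanish on the singular set (Mathlib's inverse is 0 there). It ties the s = 2 endpoint of
the mobility-gap bounds to ⟨P_fg P_gf⟩ and hence to `HasLatticeMassGap`'s flavoured channels.
[difficulty: provable-now] [MontvayMunster1994, Weingarten1983,
tree:Literature.MathematicalPhysics.QuantumLattice.wilsonDirac_gammaFive_hermitian_holds]

TWO-LAYER PLAN. Foreseen, NOT filed now (k ≤ 3, depth 1). CriticalLineExists ⇐
IndexQuantisedOnMobilityGap (PSB Cor. 6.5.2 ported to the
covariant family U ↦ Γ₅D_W[U](m₀) over (SU(3)^edges(ℤ⁴), translation-invariant Wilson DLR states,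
ℤ⁴): the strong second Chern
number is an a.s. integer, constant along deformations in m₀ and along U ↦ U^t while MBGH holds;
needs the definition requests)
→ PlateauValues (C = 0 for m₀ > 0 via TrivialPlateauGap + deformation to m₀ → +∞; C(−1; β) = 1 for β
≥ β₁ via
InteriorPlateauLocalisation along the contraction and the free value of GJK93 / PSB §2.2.4) →
CriticalLineExists (compactness:
pointwise MBGH on [−1,1] with locally uniform constants ⇒ the uniform bound).
PhysicalPlateauMobilityGap ⇐
BlockedKernelMobilityGap (after j(k) ≈ log(1/(a_k μ₁)) Bałaban–BOS steps the small-field effective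
kernel is a Wilson–Dirac-type
operator with O(1) gap in block units and weak residual disorder) → SingleScaleLifshitzLocalisation
(InteriorPlateauLocalisation's
proof at the last scale, large fields handled by adj D / |det| factors) →
PhysicalPlateauMobilityGap. PlateauBridge ⇐
QuarkLineDomination (Weingarten γ₅-domination for general `QCDLatticeObservable` pairs, flavoured
part of HasLatticeMassGap from the
moments) → SeaDefectGas (quasi-local log|det| + localised sign crossings as a polymer gas with
activity → 0 in k) →
RobustYMClustering (the core; candidate import from a robust `YangMills` route) → PlateauBridge.

KILL CRITERIA. InteriorPlateauLocalisation refuted (delocalised in-gap spectrum at m₀ = −1 for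
arbitrarily large β, e.g. the first Aoki finger
provably swallowing m₀ = −1 at all couplings, or a theorem that Haar-link conditional densities
cannot supply a Wegner estimate
beating the dislocation entropy) closes the route `refuted:InteriorPlateauLocalisation` — it kills
the engine of C and the toy rung
of P (and the sister card with it). CriticalLineExists refuted (a uniform mobility gap across m₀ ∈
[−1,1] at some large β) means
the index dictionary fails for Gibbs gauge disorder (C(−1) ≠ 1 or no quantisation): close
`refuted:CriticalLineExists` and record
which porting step broke. PhysicalPlateauMobilityGap refuted by an admissible
counter-regularisation: if only the window/rate
constants are wrong, restate once (bare-rate version); if only the edge clause fails (gapless set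
not above one flavour-blind
threshold), restate once with a flavour-wise threshold; if the rate must be bare in physical units
the plateau reading of the
physical side is dead — close. PlateauBridge can only die with robust SU(3) Yang–Mills, which closes
every fermion-side QCD route
alike. Mooted: if a heavy-threshold or gradient-flow route lands `QCDOf` first, the chain P → B → E
is superseded but Y = L ∧ C
(the critical-line theorem) survives as a standalone deliverable and as the definition of m_crit.

NOT DECOMPOSED YET. The index vocabulary itself (mobility-gap predicate, finite-volume second Chern
number via the half-signature of the spectral
localizer, topologicalCriticalMass — definition requests filed at open, nothing typed over them
until they land); the
infinite-volume Wilson DLR state and its ergodic decomposition (inside IndexQuantisedOnMobilityGap);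
the Wegner estimate from
single-link conditional Haar densities and the dislocation large-deviation bound (children of L);
block-RG vocabulary for fermions
in a dynamical non-abelian field (needed even to type BlockedKernelMobilityGap); the unquenched (N_f
= 2 phase-quenched) version
of L and of C; Move 3's sign classification as a statement (odd-N_f weight = phase-quenched weight ×
(−1)^ν with ν local on the
trivial plateau, θ = π-like below m_c) — kept as dictionary prose until B moves; constants c(M̄),
the superheavy window, and the
transfer-matrix passage. All layer 2, after a crux moves.

CHEAPEST FALSIFIER. Quenched exact diagonalisation, one kit job (not run here — the hub is
compute-free and this seat is one-shot): SU(2) or SU(3),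
6⁴–8⁴, β_W ∈ {5.8, 6.0, 6.2} and one very large β, Γ₅D_W at m₀ = −1: inverse participation ratios
and level-spacing statistics
of the in-gap modes (|E| ≤ 0.3) and the volume scaling of E‖G(0,v; E + iη)‖^s at η = 10⁻³. EXTENDED
in-gap modes (IPR ∼ 1/V,
GUE spacing) persisting as β grows kill InteriorPlateauLocalisation and with it C;
Golterman–Shamir–Svetitsky report λ_c > 0
there (localised), so survival is expected. Cheaper still and already settled on paper: the free
plateau table 0, 1, −3, 3, −1,
0 (GoltermanJansenKaplan1993; Kimura2016 eq. (2.10); ProdanSchulzbaldes2016 §2.2.4) and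
TrivialPlateauGap (m₀ > 0 is gapped
pathwise), which fix the two ends of the forcing argument; and the reading check that PSB's MBGH
(2.51) is exactly the bound
typed in L, P, C (it is: ProdanSchulzbaldes2016 §2.4, Def. 2.4.3).

NUMBERS. Free critical Wilson masses m₀ ∈ {0, −2, −4, −6, −8} (r = 1); free second Chern numbers 0,
1, −3, 3, −1, 0 (jumps +1, −4, +6,
−4, +1 = doublers with chirality; GoltermanJansenKaplan1993, Kimura2016 (2.10)).
Edwards–Heller–Narayanan: on SU(3) at β_W = 5.7
the gap of Γ₅D_W closes at m₁ = 1.02 (their m = −m₀) and stays closed to m = 2, with κ_c inside that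
region; m₁ decreases
towards weak coupling (EdwardsHellerNarayanan1998 §1–2) — so m₀ = −1 is supercritical but, per
GoltermanShamirSvetitsky2005, in
the λ_c > 0 (localised) region at β_W ≈ 6.0 where domain-wall kernels with M₅ up to 1.8 are local.
Aoki finger width ∼ (aΛ)³
against the trajectory offset a_k m/Z_m(k) (SharpeSingleton1998); Z_m(k) ≍ (log a_k⁻²)^(4/9) (N_f =
3, tree
`massExponent_three`), ^(12/29) (N_f = 2); spectral gap of |Γ₅D_W| on N_f = 2 ensembles: median ∝
Z_A a m, width ∝ a/√V
(doi:10.1088/1126-6708/2006/02/011). Items at open: 9 (5 cruxes, 3 supports, 1 assembly).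

DEFINITION REQUESTS. Filed right after open, all `--for` CriticalLineExists, topic
Literature/MathematicalPhysics/QuantumLattice (next to
`wilsonDirac`; no random-operator or index vocabulary exists in the tree — `lean search 'mobility'`,
`'Chern'`, `'Fredholm
index'` give nothing usable): (D1) `MobilityGapAt` — the Aizenman–Molchanov fractional-moment
mobility-gap predicate (PSB
(2.51)) for a measurable family U ↦ H(U) of finite Hermitian matrices indexed by torus site ×
internal index under a family of
probability measures, uniform in the torus side; (D2) `localizerIndex` — the finite-volume even
index pairing as the
half-signature of the spectral localizer κ(X·Γ) ⊗ 1 + H ⊗ σ restricted to a ball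
(LozanoviescaSchoberSchulzbaldes2019,
LoringSchulzbaldes2020), the Lean-definable surrogate of the second noncommutative Chern number,
with its a.s. large-volume
limit `chernNumberTwo β m₀`; (D3) `topologicalCriticalMass β := sInf {m₀ | ∀ m₀' ≥ m₀, MobilityGapAt
… (Γ₅D_W(·, m₀', 1)) ∧
chernNumberTwo β m₀' = 0}` — the index-defined critical bare Wilson mass offered to
`QCDRegularisation.mcrit`. Cite fact wanted
(family constructive-qft): ProdanSchulzbaldes2016 Thm 6.5.1 / Cor. 6.5.2 (index formula,
quantisation and deformation invariance
of the strong even Chern number under MBGH) and Prop. 2.4.4 (MBGH ⇒ exponentially localised Fermi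
projection).

Novelty: Searches (2026-08-15): `lit search` local/hybrid index unavailable all session (searchd rc 75;
OpenAlex 429), so: `lit galaxy
search "topological Anderson insulator" --star all` (22 rows: PSB book panama:243232587907097, TAI
numerics arXiv:2401.03028, no
lattice-QCD link); `lit galaxy search "Chern-Simons currents and chiral fermions on the lattice"
--star all` (3: PSB cite GJK93 as
[74] for the Chern numbers of their model (2.24) — read §2.2.4, §2.4 (MBGH (2.51), Def. 2.4.3, Prop.
2.4.4), §6.5 (Thm 6.5.1,
Cor. 6.5.2) from the materialised text); `lit read arxiv:hep-lat/0306002 --grep`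
(GoltermanShamir2003 §4, §6: the λ_c = 0
fingers are argued plausible, "a conjecture, and we have no proof"; no index/Chern argument); `lit
read arxiv:1511.08286`
(Kimura2016: free ν₄D table (2.10), TI ↔ domain-wall dictionary, no disorder / Aoki phase); `lit
search --source crossref` ×7:
"Wilson fermion Aoki phase topological insulator Chern number lattice QCD" (13: Aoki 1984/87,
Kimura–Misumi–Ohnishi 2012 PoS —
phase diagrams, no index definition), "domain-wall fermion topological insulator Kimura" (Kimura2016
found), "Germinet Klein
Schenker delocalization Landau" (doi:10.4007/annals.2007.166.215), "non-commutative nth Chern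
number" (ProdanLeungBellissard2013),
"Golterman Jansen Kaplan 1993" (doi:10.1016/0370-2693(93)90692-b), "index of lattice Dirac operators
K-theory" (AokiEtAl2026
doi:10.1007/s11005-026-02080-w; PTEP 2025 doi:10.1093/ptep/ptaf087 — deterministic admissible
backgrounds, sp  [refs: 10.4007/annals.2007.166.215, 10.1016/0370-2693(93, 10.1007/s11005-026-02080-w, 10.1093/ptep/ptaf087, 2401.03028, hep-lat/0306002, 1511.08286, arxiv:hep-lat/0306002, arxiv:1511.08286, doi:10.4007/annals.2007.166.215, doi:10.1016/0370-2693, doi:10.1007/s11005-026-02080-w, doi:10.1093/ptep/ptaf087, GoltermanShamir2003, Kimura2016, ProdanLeungBellissard2013, AokiEtAl2026, LoringSchulzbaldes2020, Lozan]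

Barriers (technique_class: noncommutative-index, random-operator-localisation): - technique_class: noncommutative-index, random-operator-localisation
- Literature.Barriers.QuantumFields.AokiPhaseDichotomy: respected and USED — region B (λ_c = 0) is
exactly where CriticalLineExists puts the delocalised spectrum; P needs only that the trajectory
offset a_k m/Z_m clears the finger width ∼ (aΛ)³ above a threshold M₀ (automatic in the c₂ < 0
scenario), which is why P is stated in threshold form.
- Literature.Barriers.QuantumFields.LinearDivergenceRenormalon: evaded by construction — m_crit is
never summed from a series; it is the jump locus of an integer (definition request D3), a
non-perturbative condition of the kind the barrier's evasions list.
- Literature.Barriers.QuantumFields.NoContinuousLatticeTopologicalCharge: consistent — the spectral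
index ν(U, m₀) (tree `wilsonSpectralIndex`) is integer-valued and DIScontinuous in U, the a.s. Chern
number is a property of the covariant family not a configuration-wise charge, and on the trivial
plateau ν is explicitly NOT a topological charge but a count of localised crossings.
- Literature.Barriers.QuantumFields.WilsonDeterminantSign: not evaded, re-read — P is stated under
the phase-quenched POSITIVE measure `qcdLatticeMeasure` and the sign (−1)^ν is handed to
PlateauBridge (ii) as a dilute localised-defect gas; its why-might-fail names the odd-exposure risk
(Mohler–Schaefer negative determinants, doi:10.1103/physrevd.102.074506).
- Literature.Barriers.QuantumFields.WilsonDeterminantMassSplitting: same treatment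

History (route lifecycle, newest last):
- 2026-08-15T16:17:42Z · rev 2: restated PhysicalPlateauMobilityGap (stmt-QuantumFields-9691), PlateauBridge (stmt-QuantumFields-9693), PionContractionEqNormSq (stmt-QuantumFields-9695) — route-repair (cone, g2): drop import Literature.MathematicalPhysics.QuantumFieldTheory.QCD (its unproved `QCD`/`QCDWith` Props are an obsolete statement form (planner-rrepair-QuantumFields-IntegerCriticalL-6f86d445-g2-0)
- 2026-08-16T23:14:20Z · rev 3: restated PhysicalPlateauMobilityGap (stmt-QuantumFields-10516), DynamicalQuarkContinuum (stmt-QuantumFields-8695) — route-repair (statement-revised p117723: `QCDOf` gained `reg.IsChiralAtZero`): DynamicalQuarkContinuum restated with `reg.IsChiralAtZero` in its conclusion (exi (planner-rrepair-QuantumFields-IntegerCriticalL-11e78e8a-0)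
- 2026-08-23T03:16:31Z · DORMANT — reconciler: no traction for 5.9 d (last activity item-evidence-added at 2026-08-17T05:53:13Z); parked, not closed — `ledger route dormant route-QuantumFields-In (operator:999:1958959)
- 2026-08-28T21:18:45Z · REACTIVATED — reconciler: reactivated — activity statement-closed at 2026-08-28T18:54:51Z after parking at 2026-08-23T03:16:31Z (operator:999:2594356)

sub-problem: QCD · status: open · opened planner-plancard-QuantumFields-QCD-integer-cr-d5a973ee-0 2026-08-15T14:12:20Z · rev 4 · ledger route-QuantumFields-IntegerCriticalLine
GENERATED by the gate from the ledger (D-0016/17). Provers cite these decls: `theorem foo : Summit.QuantumFields.QCD.Theses.IntegerCriticalLine.<Decl> := …` in Summits/QuantumFields/QCD/Theorems/<Name>.lean.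
-/

namespace Summit.QuantumFields.QCD.Theses.IntegerCriticalLine

open scoped BigOperators Topology Manifold Classical MeasureTheory ProbabilityTheory Matrix InnerProductSpace ComplexConjugate ContinuousMap
open Filter Set Function TopologicalSpace MeasureTheory

attribute [summit_statement] _root_.QCD

/-- item stmt-QuantumFields-9690 · crux · rank 2 · open · by planner
why it might fail: No localisation theorem covers Gibbs-correlated non-abelian unitary LINK disorder: the Wegner input must come from single-link conditional Haar densities (Lipschitz ~e^{cβ}) and be beaten by the e^{-c'β} dislocation weight, uniformly in β ≥ β₁ and in all tori (nearest proof: iid U(1) flux, d=2).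
sources: AizenmanMolchanov1993, AizenmanGraf1998, KloppEtAl2003, GoltermanShamir2003, GoltermanShamirSvetitsky2005MobilityEdge, GoltermanShamirSvetitsky2005
[crux] (card K1, quenched form) there are β₁, s ∈ (0,1), E₀ > 0, C and c > 0 such that for every
inverse coupling β ≥ β₁ (tree normalisation β = 2/g₀², `wilsonMeasure` with the fundamental SU(3)
representation), every torus of side 2S+1, every energy |E| ≤ E₀, every η > 0, every displacement v
∈ ℤ⁴ with |v_i| ≤ S and all colour/spin indices, the Wilson-measure expectation of the s-th power of
the (0,a,α; v,b,γ) entry of the resolvent (Γ₅D_W(U, m₀ = −1, r = 1) − E − iη)⁻¹ is at most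
C·exp(−c|v|₁): at weak coupling the kernel in the first topological pocket has 0 in an
Aizenman–Molchanov mobility gap (PSB's MBGH (2.51)), uniformly in the volume — the first
localisation theorem for non-abelian Haar-link (Gibbs) disorder, toy rung of
PhysicalPlateauMobilityGap and engine of CriticalLineExists. [difficulty: L] -/
@[route_item "route-QuantumFields-IntegerCriticalLine"]
def InteriorPlateauLocalisation : Prop :=
  ∃ β₁ s E₀ C c : ℝ, 0 < s ∧ s < 1 ∧ 0 < E₀ ∧ 0 < c ∧ ∀ β : ℝ, β₁ ≤ β → ∀ (S : ℕ) (E η : ℝ), |E| ≤ E₀ → 0 < η → ∀ v : Fin 4 → ℤ, (∀ i, |v i| ≤ S) → ∀ (a b : Fin 3) (α γ : Fin 4), ∫ U : Literature.MathematicalPhysics.QuantumFieldTheory.GaugeConfig 4 (2 * S + 1) (Matrix.specialUnitaryGroup (Fin 3) ℂ), ‖(Literature.Barriers.QuantumFields.WilsonDeterminant.hermitianWilsonDirac (Literature.MathematicalPhysics.QuantumLattice.fundamentalRep (Fin 3)) U (-1) 1 - ((E : ℂ) + (η : ℂ) * Complex.I) • 1 : Matrix (Literature.Probability.LatticeModels.TorusSite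 4 (2 * S + 1) × Fin 3 × Fin 4) (Literature.Probability.LatticeModels.TorusSite 4 (2 * S + 1) × Fin 3 × Fin 4) ℂ)⁻¹ ((0 : Literature.Probability.LatticeModels.TorusSite 4 (2 * S + 1)), a, α) (Literature.Probability.LatticeModels.Torus.proj (2 * S + 1) v, b, γ)‖ ^ s ∂(Literature.MathematicalPhysics.QuantumFieldTheory.wilsonMeasure (d := 4) (L := 2 * S + 1) (Literature.MathematicalPhysics.QuantumLattice.fundamentalRep (Fin 3)) β) ≤ C * Real.exp (-(c * ∑ i, |(v i : ℝ)|))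

-- earlier PhysicalPlateauMobilityGap (stmt-QuantumFields-10516, replaced 2026-08-16T23:14:20Z -> stmt-QuantumFields-17299): retired by None — ∀ (Nf : ℕ) (reg : Literature.MathematicalPhysics.QuantumFieldTheory.QCDRegularisation Nf), (Nf = 2 ∨ Nf = 3) → reg.HasMassScaling → (∀ m : Fin Nf → ℝ, (∀ f, 0 < m f) → ∃ (z shift : Literature.MathematicalPhysics.QuantumFieldTheory.QCDField Nf → ℕ → ℝ) (T : Lit
-- earlier PhysicalPlateauMobilityGap (stmt-QuantumFields-9691, replaced 2026-08-15T16:17:42Z -> stmt-QuantumFields-10516): retired by None — ∀ (Nf : ℕ) (reg : Literature.MathematicalPhysics.QuantumFieldTheory.QCDRegularisation Nf), (Nf = 2 ∨ Nf = 3) → reg.HasMassScaling → (∀ m : Fin Nf → ℝ, (∀ f, 0 < m f) → ∃ (z shift : Literature.MathematicalPhysics.QuantumFieldTheory.QCDField Nf → ℕ → ℝ) (T : Lite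
/-- item stmt-QuantumFields-17299 · crux · rank 3 · open · by planner
why it might fail: Gap/disorder → 0 at the cutoff (a·m/Z_m vs g₀²): E≈0 localisation needs block RG down to scale 1/m with dynamical quarks (nonexistent) and a RENORMALISED rate; the edge clause also dies if an admissible chiral reg is gapless only at split tuples, not above one flavour-blind M₀.
sources: GoltermanShamir2003, doi:10.1088/1126-6708/2006/02/011, AizenmanMolchanov1993, BalabanOcarrollSchor1989, SharpeSingleton1998, MontvayMunster1994
[crux] (card K3, statement-exact, re-typed 2026-08-16 for `reg.IsChiralAtZero`; in the assembly) for
N_f ∈ {2,3} and every `reg : QCDRegularisation N_f` with `HasMassScaling` and `IsChiralAtZero`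
carrying admissibility data (for every m > 0 some z, shift, T with `IsQCDAlong (reg.scheme m z
shift) T` and `T.IsNontrivial (pseudoRe f g)` for f ≠ g), there are a SHARP flavour-blind threshold
M₀ ≥ 0 and s ∈ (0,1) such that (edge) for every ε > 0 some tuple m with all m_f > M₀ has NO uniform
lattice gap ε, `¬ (reg.scheme m 0 0).HasLatticeMassGap ε` — the lattice gap closes as m ↓ M₀, so M₀
is the chiral point of `reg` in renormalised units (for an honest regularisation M₀ = 0 and the edge
clause IS the hypothesis `IsChiralAtZero`; M₀ > 0 only absorbs a critical bare mass placed below the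
chiral line) — and (plateau) for every window bound M̄ there is c > 0 with: for every tuple m ∈ (M₀,
M̄]^N_f some C, eventually in k, on every torus 2S+1 ≥ 2L_k+1, for every flavour f, every |E| ≤
c·a_k(m_f − M₀)/Z_m(k), every η > 0, every v with |v_i| ≤ S and all indices, the phase-quenched
expectation (ratio of ∏_g‖fermionDet (wilsonDirac ρ U m_g(k) 1)‖-weighted `wilsonMeasure` integrals,
ρ = `fundamen -/
@[route_item "route-QuantumFields-IntegerCriticalLine", crux]
def PhysicalPlateauMobilityGap : Prop :=
  ∀ (Nf : ℕ) (reg : Literature.MathematicalPhysics.QuantumFieldTheory.QCDRegularisation Nf), (Nf = 2 ∨ Nf = 3) → reg.HasMassScaling → reg.IsChiralAtZero → (∀ m : Fin Nf → ℝ, (∀ f, 0 < m f) → ∃ (z shift : Literature.MathematicalPhysics.QuantumFieldTheory.QCDField Nf → ℕ → ℝ) (T : Literature.MathematicalPhysics.QuantumFieldTheory.OSData (Literature.MathematicalPhysics.QuantumFieldTheory.QCDField Nf) 4), Literature.MathematicalPhysics.QuantumFieldTheory.IsQCDAlong (reg.scheme m z shift) T ∧ ∀ f g : Fin Nf, f ≠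 g → T.IsNontrivial (Literature.MathematicalPhysics.QuantumFieldTheory.QCDField.pseudoRe f g)) → ∃ M₀ s : ℝ, 0 ≤ M₀ ∧ 0 < s ∧ s < 1 ∧ (∀ ε : ℝ, 0 < ε → ∃ m : Fin Nf → ℝ, (∀ f, M₀ < m f) ∧ ¬ (reg.scheme m 0 0).HasLatticeMassGap ε) ∧ ∀ Mbar : ℝ, ∃ c : ℝ, 0 < c ∧ ∀ m : Fin Nf → ℝ, (∀ f, M₀ < m f ∧ m f ≤ Mbar) → ∃ C : ℝ, ∀ᶠ k in atTop, ∀ S : ℕ, reg.L k ≤ S → ∀ (f : Fin Nf) (E η : ℝ), |E| ≤ c * (reg.a k * (m f - M₀) / reg.Zm k) → 0 < η → ∀ v : Fin 4 → ℤ, (∀ i, |v i| ≤ S) → ∀ (a b : Fin 3) (α γ : Fin 4), (∫ U : Literature.MathematicalPhysics.QuantumFieldTheory.GaugeConfig 4 (2 * S + 1) (Matrix.specialUnitaryGroup (Fin 3) ℂ), (∏ g : Fin Nf, ‖Literature.MathematicalPhysics.QuantumLattice.fermionDet (Literature.MathematicalPhysics.QuantumLattice.wilsonDirac (Literature.MathematicalPhysics.QuantumLattice.fundamentalRep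 (Fin 3)) U (reg.mcrit k + reg.a k * m g / reg.Zm k) 1)‖) * ‖(Literature.Barriers.QuantumFields.WilsonDeterminant.hermitianWilsonDirac (Literature.MathematicalPhysics.QuantumLattice.fundamentalRep (Fin 3)) U (reg.mcrit k + reg.a k * m f / reg.Zm k) 1 - ((E : ℂ) + (η : ℂ) * Complex.I) • 1 : Matrix (Literature.Probability.LatticeModels.TorusSite 4 (2 * S + 1) × Fin 3 × Fin 4) (Literature.Probability.LatticeModels.TorusSite 4 (2 * S + 1) × Fin 3 × Fin 4) ℂ)⁻¹ ((0 : Literature.Probability.LatticeModels.TorusSite 4 (2 * S + 1)), a, α) (Literature.Probability.LatticeModels.Torus.proj (2 * S + 1) v, b, γ)‖ ^ s ∂(Literature.MathematicalPhysics.QuantumFieldTheory.wilsonMeasure (d := 4) (L := 2 * S + 1) (Literature.MathematicalPhysics.QuantumLattice.fundamentalRep (Fin 3)) (reg.β k))) / (∫ U : Literature.MathematicalPhysics.QuantumFieldTheory.GaugeConfig 4 (2 * S + 1) (Matrix.specialUnitaryGroup (Fin 3) ℂ), ∏ g : Fin Nf, ‖Literature.MathematicalPhysics.QuantumLattice.fermionDet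 (Literature.MathematicalPhysics.QuantumLattice.wilsonDirac (Literature.MathematicalPhysics.QuantumLattice.fundamentalRep (Fin 3)) U (reg.mcrit k + reg.a k * m g / reg.Zm k) 1)‖ ∂(Literature.MathematicalPhysics.QuantumFieldTheory.wilsonMeasure (d := 4) (L := 2 * S + 1) (Literature.MathematicalPhysics.QuantumLattice.fundamentalRep (Fin 3)) (reg.β k))) ≤ C * Real.exp (-(c * (reg.a k * (m f - M₀)) * ∑ i, |(v i : ℝ)|))

/-- item stmt-QuantumFields-9692 · crux · rank 4 · open · by planner
why it might fail: Forcing needs PSB Ch.6/GKS ported to Wilson Gibbs states at MOBILITY-gap strength from finite-torus bounds (a.s. Chern number quantised, locally constant) and C(−1;β)=1, reachable only as β′→∞ via β-uniform InteriorPlateauLocalisation (U↦U^t is gauge-dependent); else the uniform bound may hold.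
sources: GerminetKleinSchenker2007, ProdanSchulzbaldes2016, ProdanLeungBellissard2013, Stoiber2025, LozanoviescaSchoberSchulzbaldes2019, GoltermanSharpeSingleton2005
[crux] (card Move 2 / K2 output, typed in PSB's finite-volume language) there is β₁ such that for
every β ≥ β₁ NO constants s ∈ (0,1), E₀ > 0, C, c > 0 make the Aizenman–Molchanov bound of
InteriorPlateauLocalisation hold simultaneously for all Wilson masses m₀ ∈ [−1, 1] (all tori, |E| ≤
E₀, η > 0, all displacements): between the first topological pocket (m₀ = −1, almost-sure second
Chern number 1 by InteriorPlateauLocalisation + the contraction homotopy U ↦ U^t + the free value)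
and the trivial insulator (m₀ > 0: pathwise gap by TrivialPlateauGap, Chern number 0) the spectrum
of Γ₅D_W at 0 is DELOCALISED somewhere (PSB Def. 2.4.3) — the Wilson chiral critical line m_c(β) ∈
(−1, 0] exists at every weak coupling as a sharp localisation–delocalisation transition, whatever
the Aoki-phase scenario; intended proof: strong even Chern numbers are constant while MBGH holds
(PSB Thm 6.5.1 / Cor. 6.5.2) — the d = 4, mass-parameter twin of Germinet–Klein–Schenker. [deps:
InteriorPlateauLocalisation] [difficulty: L] -/
@[route_item "route-QuantumFields-IntegerCriticalLine"]
def CriticalLineExists : Prop :=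
  ∃ β₁ : ℝ, ∀ β : ℝ, β₁ ≤ β → ¬ ∃ s E₀ C c : ℝ, 0 < s ∧ s < 1 ∧ 0 < E₀ ∧ 0 < c ∧ ∀ m₀ : ℝ, -1 ≤ m₀ → m₀ ≤ 1 → ∀ (S : ℕ) (E η : ℝ), |E| ≤ E₀ → 0 < η → ∀ v : Fin 4 → ℤ, (∀ i, |v i| ≤ S) → ∀ (a b : Fin 3) (α γ : Fin 4), ∫ U : Literature.MathematicalPhysics.QuantumFieldTheory.GaugeConfig 4 (2 * S + 1) (Matrix.specialUnitaryGroup (Fin 3) ℂ), ‖(Literature.Barriers.QuantumFields.WilsonDeterminant.hermitianWilsonDirac (Literature.MathematicalPhysics.QuantumLattice.fundamentalRep (Fin 3)) U m₀ 1 - ((E : ℂ) + (η : ℂ) * Complex.I) • 1 : Matrix (Literature.Probability.LatticeModels.TorusSite 4 (2 * S + 1) × Fin 3 × Fin 4) (Literature.Probability.LatticeModels.TorusSite 4 (2 * S + 1) × Fin 3 × Fin 4) ℂ)⁻¹ ((0 : Literature.Probability.LatticeModels.TorusSite 4 (2 * S + 1)), a, α) (Literature.Probability.LatticeModels.Torus.proj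 (2 * S + 1) v, b, γ)‖ ^ s ∂(Literature.MathematicalPhysics.QuantumFieldTheory.wilsonMeasure (d := 4) (L := 2 * S + 1) (Literature.MathematicalPhysics.QuantumLattice.fundamentalRep (Fin 3)) β) ≤ C * Real.exp (-(c * ∑ i, |(v i : ℝ)|))

-- earlier PlateauBridge (stmt-QuantumFields-9693, replaced 2026-08-15T16:17:42Z -> stmt-QuantumFields-10517): retired by None — ∀ (Nf : ℕ) (reg : Literature.MathematicalPhysics.QuantumFieldTheory.QCDRegularisation Nf) (M₀ s : ℝ), (Nf = 2 ∨ Nf = 3) → reg.HasMassScaling → (∀ m : Fin Nf → ℝ, (∀ f, 0 < m f) → ∃ (z shift : Literature.MathematicalPhysics.QuantumFieldTheory.QCDField Nf → ℕ → ℝ) (T : Litera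
/-- item stmt-QuantumFields-10517 · crux · rank 5 · open · by planner
why it might fail: (iii) is a robust SU(3) Yang–Mills lattice gap under quasi-local SIGNED fermionic perturbations (Millennium-grade, no technique); for odd exposure (N_f=3, split doublets) (−1)^ν must be a dilute gas of localised defects on ALL tori S ≥ L_k, yet ⟨sign⟩_{|w|} can decay exponentially in the volume.
sources: JaffeWitten2000, Weingarten1983, ProdanSchulzbaldes2016, Luscher1977, Balaban1989LargeFieldII, doi:10.1103/physrevd.102.074506
[crux] (the card's consumer, statement-exact; in the assembly) for N_f ∈ {2,3}, every admissible
`reg` with `HasMassScaling`, every M₀ ≥ 0 and s ∈ (0,1) for which the conclusion of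
PhysicalPlateauMobilityGap holds (verbatim, in its route-repair-g2 ratio form over `wilsonMeasure`
reweighted by ∏_g ‖fermionDet (wilsonDirac ρ U m_g(k) 1)‖): for all m with every m_f > M₀ and all z,
shift, T with `IsQCDAlong (reg.scheme m z shift) T` there is Δ > 0 with `T.HasMassGap Δ ∧
(reg.scheme m z shift).HasLatticeMassGap Δ`. Content: (i) flavoured channels — γ₅-domination
(Weingarten) bounds every quark-line-connected correlator of `QCDLatticeObservable`s by moments of
the propagator, whose s = 2 endpoint is the pseudoscalar correlator (PionContractionEqNormSq); (ii)
sea — in the mobility gap the Fermi projection and log|det D_W| are quasi-local in U (PSB Prop.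
2.4.4) and sign det D_W(m_f(k)) = (−1)^ν with ν a count of LOCALISED level crossings on the trivial
plateau (tree `fermionDet_wilsonDirac_eq_sign_mul`; card Move 3), so the signed N_f-flavour weight
is a quasi-local, dilute-defect perturbation of Wilson's action; (iii) volume-uniform clustering of
such perturbed SU(3) measures at weak coup -/
@[route_item "route-QuantumFields-IntegerCriticalLine", crux]
def PlateauBridge : Prop :=
  ∀ (Nf : ℕ) (reg : Literature.MathematicalPhysics.QuantumFieldTheory.QCDRegularisation Nf) (M₀ s : ℝ), (Nf = 2 ∨ Nf = 3) → reg.HasMassScaling → (∀ m : Fin Nf → ℝ, (∀ f, 0 < m f) → ∃ (z shift : Literature.MathematicalPhysics.QuantumFieldTheory.QCDField Nf → ℕ → ℝ) (T : Literature.MathematicalPhysics.QuantumFieldTheory.OSData (Literature.MathematicalPhysics.QuantumFieldTheory.QCDField Nf) 4), Literature.MathematicalPhysics.QuantumFieldTheory.IsQCDAlong (reg.scheme m z shift) T ∧ ∀ f g : Fin Nf, f ≠ g → T.IsNontrivial (Literature.MathematicalPhysics.QuantumFieldTheory.QCDField.pseudoRe f g)) → 0 ≤ M₀ → 0 < s →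 s < 1 → (∀ Mbar : ℝ, ∃ c : ℝ, 0 < c ∧ ∀ m : Fin Nf → ℝ, (∀ f, M₀ < m f ∧ m f ≤ Mbar) → ∃ C : ℝ, ∀ᶠ k in atTop, ∀ S : ℕ, reg.L k ≤ S → ∀ (f : Fin Nf) (E η : ℝ), |E| ≤ c * (reg.a k * (m f - M₀) / reg.Zm k) → 0 < η → ∀ v : Fin 4 → ℤ, (∀ i, |v i| ≤ S) → ∀ (a b : Fin 3) (α γ : Fin 4), (∫ U : Literature.MathematicalPhysics.QuantumFieldTheory.GaugeConfig 4 (2 * S + 1) (Matrix.specialUnitaryGroup (Fin 3) ℂ), (∏ g : Fin Nf, ‖Literature.MathematicalPhysics.QuantumLattice.fermionDet (Literature.MathematicalPhysics.QuantumLattice.wilsonDirac (Literature.MathematicalPhysics.QuantumLattice.fundamentalRep (Fin 3)) U (reg.mcrit k + reg.a k * m g / reg.Zm k) 1)‖) * ‖(Literature.Barriers.QuantumFields.WilsonDeterminant.hermitianWilsonDirac (Literature.MathematicalPhysics.QuantumLattice.fundamentalRep (Fin 3)) U (reg.mcrit k + reg.a k * m f / reg.Zm k) 1 - ((E : ℂ)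 + (η : ℂ) * Complex.I) • 1 : Matrix (Literature.Probability.LatticeModels.TorusSite 4 (2 * S + 1) × Fin 3 × Fin 4) (Literature.Probability.LatticeModels.TorusSite 4 (2 * S + 1) × Fin 3 × Fin 4) ℂ)⁻¹ ((0 : Literature.Probability.LatticeModels.TorusSite 4 (2 * S + 1)), a, α) (Literature.Probability.LatticeModels.Torus.proj (2 * S + 1) v, b, γ)‖ ^ s ∂(Literature.MathematicalPhysics.QuantumFieldTheory.wilsonMeasure (d := 4) (L := 2 * S + 1) (Literature.MathematicalPhysics.QuantumLattice.fundamentalRep (Fin 3)) (reg.β k))) / (∫ U : Literature.MathematicalPhysics.QuantumFieldTheory.GaugeConfig 4 (2 * S + 1) (Matrix.specialUnitaryGroup (Fin 3) ℂ), ∏ g : Fin Nf, ‖Literature.MathematicalPhysics.QuantumLattice.fermionDet (Literature.MathematicalPhysics.QuantumLattice.wilsonDirac (Literature.MathematicalPhysics.QuantumLattice.fundamentalRep (Fin 3)) U (reg.mcrit k + reg.a k * m g / reg.Zm k) 1)‖ ∂(Literature.MathematicalPhysics.QuantumFieldTheory.wilsonMeasure (d := 4) (L := 2 * S + 1) (Literature.MathematicalPhysics.QuantumLattice.fundamentalRep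 (Fin 3)) (reg.β k))) ≤ C * Real.exp (-(c * (reg.a k * (m f - M₀)) * ∑ i, |(v i : ℝ)|))) → ∀ m : Fin Nf → ℝ, (∀ f, M₀ < m f) → ∀ (z shift : Literature.MathematicalPhysics.QuantumFieldTheory.QCDField Nf → ℕ → ℝ) (T : Literature.MathematicalPhysics.QuantumFieldTheory.OSData (Literature.MathematicalPhysics.QuantumFieldTheory.QCDField Nf) 4), Literature.MathematicalPhysics.QuantumFieldTheory.IsQCDAlong (reg.scheme m z shift) T → ∃ Δ : ℝ, 0 < Δ ∧ T.HasMassGap Δ ∧ (reg.scheme m z shift).HasLatticeMassGap Δ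

-- earlier DynamicalQuarkContinuum (stmt-QuantumFields-8695, replaced 2026-08-16T23:14:20Z -> stmt-QuantumFields-17300): open — ∀ Nf : ℕ, (Nf = 2 ∨ Nf = 3) → ∃ reg : Literature.MathematicalPhysics.QuantumFieldTheory.QCDRegularisation Nf, reg.HasMassScaling ∧ ∀ m : Fin Nf → ℝ, (∀ f, 0 < m f) → ∃ (z shift : Literature.MathematicalPhysics.QuantumFieldTheory.QCDField Nf → ℕ → ℝ) (T : Literature.Mathemati
/-- item stmt-QuantumFields-17300 · crux · rank 6 · open · by planner
why it might fail: No 4D construction with dynamical fermions exists (Bałaban: pure YM; BOS 1989: external gauge fields; Dimock: QED₃); IsChiralAtZero further imports gaplessness of lattice N_f ≥ 2 QCD at the critical line (light pions): m_crit must hit the chiral point within o(a_k/Z_m(k)).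
sources: Balaban1988Convergent, BalabanOcarrollSchor1989, Dimock2022QED3, JaffeWitten2000, MontvayMunster1994, SharpeSingleton1998
[crux] (the UV existence half shared by every QCD line, stated gap-free and — statement re-type
2026-08-16 — PINNED AT THE CHIRAL POINT; in the assembly) for N_f = 2 and N_f = 3 there is `reg :
QCDRegularisation N_f` with `HasMassScaling` and `IsChiralAtZero` (for every ε > 0 some positive
mass tuple has no uniform lattice gap ε: the lattice gap closes as m → 0⁺) such that for every m > 0
some z, shift and `T : OSData (QCDField N_f) 4` satisfy `IsQCDAlong (reg.scheme m z shift) T`,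
`T.IsNontrivial glue`, `T.IsNonGaussian glue` and `T.IsNontrivial (pseudoRe f g)` for all f ≠ g —
literally `QCDOf N_f` without its gap clause. On this line `reg.mcrit k` is OFFERED the index-jump
mass m_c(β_k) of CriticalLineExists (definition request topologicalCriticalMass), and
`IsChiralAtZero` becomes the claim that the index jump IS the chiral point: where the spectrum of
Γ₅D_W at 0 delocalises, the second moment of the E = 0 Green function — the flavoured pseudoscalar
correlator (PionContractionEqNormSq) — loses uniform exponential decay. [difficulty: open-problem] -/
@[route_item "route-QuantumFields-IntegerCriticalLine", crux]
def DynamicalQuarkContinuum : Prop :=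
  ∀ Nf : ℕ, (Nf = 2 ∨ Nf = 3) → ∃ reg : Literature.MathematicalPhysics.QuantumFieldTheory.QCDRegularisation Nf, reg.HasMassScaling ∧ reg.IsChiralAtZero ∧ ∀ m : Fin Nf → ℝ, (∀ f, 0 < m f) → ∃ (z shift : Literature.MathematicalPhysics.QuantumFieldTheory.QCDField Nf → ℕ → ℝ) (T : Literature.MathematicalPhysics.QuantumFieldTheory.OSData (Literature.MathematicalPhysics.QuantumFieldTheory.QCDField Nf) 4), Literature.MathematicalPhysics.QuantumFieldTheory.IsQCDAlong (reg.scheme m z shift) T ∧ T.IsNontrivial Literature.MathematicalPhysics.QuantumFieldTheory.QCDField.glue ∧ T.IsNonGaussian Literature.MathematicalPhysics.QuantumFieldTheory.QCDField.glue ∧ ∀ f g : Fin Nf, f ≠ g → T.IsNontrivial (Literature.MathematicalPhysics.QuantumFieldTheory.QCDField.pseudoRe f g)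

-- earlier PionContractionEqNormSq (stmt-QuantumFields-9695, replaced 2026-08-15T16:17:42Z -> stmt-QuantumFields-10518): retired by None — ∀ (L : ℕ) [NeZero L] (U : Literature.MathematicalPhysics.QuantumFieldTheory.GaugeConfig 4 L (Matrix.specialUnitaryGroup (Fin 3) ℂ)) (m : ℝ) (x y : Literature.Probability.LatticeModels.TorusSite 4 L), Literature.MathematicalPhysics.QuantumFieldTheory.pionContractio
/-- item stmt-QuantumFields-10518 · support · rank 9 · closed · proved by Summit.QuantumFields.QCD.Theorems.integerCriticalLine_pionContractionEqNormSq_proof (prover) · by planner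
sources: MontvayMunster1994, Weingarten1983, tree:Literature.MathematicalPhysics.QuantumLattice.wilsonDirac_gammaFive_hermitian_holds
[support] (dictionary entry "second moment of the E = 0 Green function = flavoured pseudoscalar
correlator"; provable now) for every SU(3) gauge field U on any four-torus, every real m and sites
x, y, the equal-mass pion contraction tr[G(x,y) γ₅ G(y,x) γ₅] = Σ_(a,b,α,β,α',β') G(x,a,α;y,b,β)
γ₅(β,β') G(y,b,β';x,a,α') γ₅(α',α) equals Σ_(a,b,α,β) |G(x,a,α; y,b,β)|², G = (wilsonDirac
(fundamentalRep (Fin 3)) U m 1)⁻¹ = D_W⁻¹ (route-repair g2: the tree's `pionContraction U m m x y` /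
`quarkPropagator U m` of QuantumFieldTheory.QCD unfolded — definitionally the same statement,
`Iff.rfl` — so the route no longer imports that file): γ₅-hermiticity (tree
`wilsonDirac_gammaFive_hermitian_holds`) gives D_W⁻¹ = Γ₅(D_W⁻¹)†Γ₅ blockwise, Γ₅ = diag(1,1,−1,−1);
both sides vanish on the singular set (Mathlib's inverse is 0 there). It ties the s = 2 endpoint of
the mobility-gap bounds to ⟨P_fg P_gf⟩ and hence to `HasLatticeMassGap`'s flavoured channels.
[difficulty: provable-now] -/
@[route_item "route-QuantumFields-IntegerCriticalLine"]
def PionContractionEqNormSq : Prop :=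
  ∀ (L : ℕ) [NeZero L] (U : Literature.MathematicalPhysics.QuantumFieldTheory.GaugeConfig 4 L (Matrix.specialUnitaryGroup (Fin 3) ℂ)) (m : ℝ) (x y : Literature.Probability.LatticeModels.TorusSite 4 L), (∑ a : Fin 3, ∑ b : Fin 3, ∑ α : Fin 4, ∑ β : Fin 4, ∑ α' : Fin 4, ∑ β' : Fin 4, (Literature.MathematicalPhysics.QuantumLattice.wilsonDirac (Literature.MathematicalPhysics.QuantumLattice.fundamentalRep (Fin 3)) U m 1)⁻¹ (x, a, α) (y, b, β) * Literature.MathematicalPhysics.QuantumLattice.gammaFive β β' * (Literature.MathematicalPhysics.QuantumLattice.wilsonDirac (Literature.MathematicalPhysics.QuantumLattice.fundamentalRep (Fin 3)) U m 1)⁻¹ (y, b, β') (x, a, α') * Literature.MathematicalPhysics.QuantumLattice.gammaFive α' α) = ∑ a : Fin 3, ∑ b : Fin 3, ∑ α : Fin 4, ∑ β : Fin 4, ((‖(Literature.MathematicalPhysics.QuantumLattice.wilsonDirac (Literature.MathematicalPhysics.QuantumLattice.fundamentalRep (Fin 3)) U m 1)⁻¹ (x, a, α) (y, b, β)‖ ^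 2 : ℝ) : ℂ)

-- `PionContractionEqNormSq` holds: proved by `Summit.QuantumFields.QCD.Theorems.integerCriticalLine_pionContractionEqNormSq_proof` (its module imports this route file, so no `_holds` link can be stated here).

/-- item stmt-QuantumFields-8699 · support · rank 9 · closed · proved by Summit.QuantumFields.QCD.Theorems.thresholdShift_proof (prover) · by planner
sources: MontvayMunster1994, tree:Literature.MathematicalPhysics.QuantumFieldTheory.QCDRegularisation.scheme_mq
[support] (assembly glue, the statement's audit-g7 shift; provable now) for every `reg` and M₀ there
is `reg'` (same a, β, L, Z_m; m_crit'(k) = m_crit(k) + a_k M₀/Z_m(k)) with `reg.HasMassScaling →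
reg'.HasMassScaling` and `reg'.scheme m z shift = reg.scheme (m + M₀) z shift` for all m, z, shift.
[difficulty: provable-now] -/
@[route_item "route-QuantumFields-IntegerCriticalLine", crux]
def ThresholdShift : Prop :=
  ∀ (Nf : ℕ) (reg : Literature.MathematicalPhysics.QuantumFieldTheory.QCDRegularisation Nf) (M₀ : ℝ), ∃ reg' : Literature.MathematicalPhysics.QuantumFieldTheory.QCDRegularisation Nf, (reg.HasMassScaling → reg'.HasMassScaling) ∧ ∀ (m : Fin Nf → ℝ) (z shift : Literature.MathematicalPhysics.QuantumFieldTheory.QCDField Nf → ℕ → ℝ), reg'.scheme m z shift = reg.scheme (fun f => m f + M₀) z shift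

/-- `ThresholdShift` holds: proved by `Summit.QuantumFields.QCD.Theorems.thresholdShift_proof`. -/
theorem ThresholdShift_holds : ThresholdShift := _root_.Summit.QuantumFields.QCD.Theorems.thresholdShift_proof

/-- item stmt-QuantumFields-9694 · support · rank 9 · closed · proved by Summit.QuantumFields.QCD.Theorems.IntegerCriticalLine.trivialPlateauGap_proof (prover) · by planner
sources: MontvayMunster1994, VafaWitten1984NPB, tree:Literature.Barriers.QuantumFields.WilsonDeterminantSign_holds
[support] (card P1(b); provable now) for a unitary colour representation ρ, any gauge field U on any
four-torus, m ≥ 0 and r ≥ 0, the Hermitian Wilson–Dirac operator satisfies ‖Γ₅D_W(U,m,r)v‖² ≥ m²‖v‖²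
for every vector v: the Hermitian part of D_W is m + (Wilson term ≥ 0), so Re⟨v, D_W v⟩ ≥ m‖v‖²,
Cauchy–Schwarz, and Γ₅ is unitary. Hence for m₀ > 0 the spectrum of H avoids (−m₀, m₀) for EVERY
configuration: the trivial insulator side (Chern number 0, Q = 0, det D_W > 0) of the dictionary,
where pathwise Combes–Thomas already gives MBGH. [difficulty: provable-now] -/
@[route_item "route-QuantumFields-IntegerCriticalLine"]
def TrivialPlateauGap : Prop :=
  ∀ (L N : ℕ) [NeZero L] (G : Type) [Group G] (ρ : G →* Matrix (Fin N) (Fin N) ℂ), (∀ g, ρ g ∈ Matrix.unitaryGroup (Fin N) ℂ) → ∀ (U : Literature.MathematicalPhysics.QuantumFieldTheory.GaugeConfig 4 L G) (m r : ℝ), 0 ≤ m → 0 ≤ r → ∀ v : Literature.Probability.LatticeModels.TorusSite 4 L × Fin N × Fin 4 → ℂ, m ^ 2 * ∑ i, ‖v i‖ ^ 2 ≤ ∑ i, ‖(Literature.Barriers.QuantumFields.WilsonDeterminant.hermitianWilsonDirac ρ U m r).mulVec v i‖ ^ 2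

-- `TrivialPlateauGap` holds: proved by `Summit.QuantumFields.QCD.Theorems.IntegerCriticalLine.trivialPlateauGap_proof` (its module imports this route file, so no `_holds` link can be stated here).

/-- item stmt-QuantumFields-9696 · assembly · rank 1 · closed · proved by Summit.QuantumFields.QCD.Theorems.integerCriticalLine_assembly_proof (prover) · by planner
sources: JaffeWitten2000, MontvayMunster1994
[assembly] PhysicalPlateauMobilityGap → PlateauBridge → DynamicalQuarkContinuum → ThresholdShift →
QCD. -/
@[route_item "route-QuantumFields-IntegerCriticalLine"]
def Assembly : Prop :=
  PhysicalPlateauMobilityGap → PlateauBridge → DynamicalQuarkContinuum → ThresholdShift → QCD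

-- `Assembly` holds: proved by `Summit.QuantumFields.QCD.Theorems.integerCriticalLine_assembly_proof` (its module imports this route file, so no `_holds` link can be stated here).

/-! D-0027 §2.1 — DECIDING THEOREM (planner-authored via `route open/edit --closes-file`; by planner-rrepair-QuantumFields-IntegerCriticalL-11e78e8a-0 2026-08-16T23:14:20Z):
its hypotheses are this route's items and its conclusion the sub-problem Statement (glue_lint), and it elaborates with this file. -/

/-- D-0027 §2.1 deciding theorem: the route's assembly chain closes the sub-problem statement
(pure logic; statement re-type 2026-08-16: `DynamicalQuarkContinuum` supplies a regularisation that is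
chiral at zero, `PhysicalPlateauMobilityGap` gives a SHARP threshold `M₀` — the lattice gap closes as
`m ↓ M₀` — so the `M₀`-shifted regularisation of `ThresholdShift` inherits `IsChiralAtZero`). -/
@[closes "route-QuantumFields-IntegerCriticalLine"] theorem closes : PhysicalPlateauMobilityGap → PlateauBridge → DynamicalQuarkContinuum →
    ThresholdShift → QCD := by
  intro hP hB hE hS
  have key : ∀ Nf : ℕ, (Nf = 2 ∨ Nf = 3) → QCDOf Nf := by
    intro Nf hNf
    obtain ⟨reg, hms, hch, hdata⟩ := hE Nf hNf
    have hadm : ∀ m : Fin Nf → ℝ, (∀ f, 0 < m f) →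
        ∃ (z shift : Literature.MathematicalPhysics.QuantumFieldTheory.QCDField Nf → ℕ → ℝ)
          (T : Literature.MathematicalPhysics.QuantumFieldTheory.OSData
            (Literature.MathematicalPhysics.QuantumFieldTheory.QCDField Nf) 4),
          Literature.MathematicalPhysics.QuantumFieldTheory.IsQCDAlong (reg.scheme m z shift) T ∧
            ∀ f g : Fin Nf, f ≠ g →
              T.IsNontrivial (Literature.MathematicalPhysics.QuantumFieldTheory.QCDField.pseudoRe f g) := by
      intro m hm
      obtain ⟨z, shift, T, h1, -, -, h4⟩ := hdata m hm
      exact ⟨z, shift, T, h1, h4⟩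
    obtain ⟨M₀, s, hM₀, hs0, hs1, hedge, hgapP⟩ := hP Nf reg hNf hms hch hadm
    have hgap := hB Nf reg M₀ s hNf hms hadm hM₀ hs0 hs1 hgapP
    obtain ⟨reg', hms', hsch⟩ := hS Nf reg M₀
    refine ⟨reg', hms' hms, ?_, fun m hm => ?_⟩
    · intro ε hε
      obtain ⟨m, hmM, hngap⟩ := hedge ε hε
      refine ⟨fun f => m f - M₀, fun f => sub_pos.mpr (hmM f), ?_⟩
      have hsch₀ := hsch (fun f => m f - M₀) 0 0
      simp only [sub_add_cancel] at hsch₀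
      rw [hsch₀]
      exact hngap
    · have hm' : ∀ f, 0 < m f + M₀ := fun f => by linarith [hm f]
      have hmM : ∀ f, M₀ < m f + M₀ := fun f => by linarith [hm f]
      obtain ⟨z, shift, T, hqcd, hnt, hng, hnd⟩ := hdata (fun f => m f + M₀) hm'
      obtain ⟨Δ, hΔ, hgapT, hgapL⟩ := hgap (fun f => m f + M₀) hmM z shift T hqcd
      refine ⟨z, shift, T, ?_, hnt, hng, hnd, Δ, hΔ, hgapT, ?_⟩
      · rw [hsch]; exact hqcd
      · rw [hsch]; exact hgapL
  exact ⟨key 2 (Or.inl rfl), key 3 (Or.inr rfl)⟩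

end Summit.QuantumFields.QCD.Theses.IntegerCriticalLine
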